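import Summits.HodgeConjecture.HodgeConjecture.Cruxes.BlochSeedDiscOne.SeedChecker
import Literature.AlgebraicGeometry.HodgeTheory.WeilCharacterDecomposition
import HarnessLib

/-!
# SEED CHECKER v9 — §12 RATIONAL DESCENT OF THE WEIL PART; (σ) and (A1@Z) DESIGN-FREE AND FRAME-FREE

Cell `pub-hsemireg`, unit `hsemireg-c5c8-1` g8 (planner, typing spec; MINT director-hodge g20 block A5 «C5–C8»).
Token: `line stmt-HodgeConjecture-18881 Cruxes/BlochSeedDiscOne/Lines/birth.lean 814a6a70c14e831a stub_rung_pad4_seedAt`.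
Satellite of `SeedChecker.lean` v4 (13437bb9848c3c36; the only built member of the series, hence the only one imported)
in the SAME namespace; every declaration name below is new w.r.t. v4–v8 (`SeedCheckerPorteous` v5, `SeedCheckerKit`
v6.2, `SeedCheckerFrame` v7.1, `SeedCheckerBalanced` v8 are not imported: unbuilt on the farm snapshot).

HONEST FRAMING. Nothing in this file is proved toward HC / HC_CM / HC_AV / №4 / 26512 / 18881 / H2, and nothing
closes or weakens `stub_rung_pad4_seedAt`: the stub stays open. This is a TYPED CHECKER plus kernel-checked linear
algebra about the anchor's cohomology; it produces evidence and typed files, not rungs.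

WHAT v9 ADDS (the g7 memo's successor item «rational descent»; C5 = (σ) and C6 = (A1@Z) made predicates on a CLASS —
`cl(Z)` or `ch₄(𝓔)` — with NO design json, NO Weil frame (obligation O-W) and NO period computation):

* §12.1 (generic `(A, φ)`, `φ ≫ φ = -(d • 𝟙 A)`): the MIXED PART `mixedPart A φ n d = ⊕_{a+b=2n, a,b ≥ 1} χ_{a,b}`
  (the tree's complement of the Weil plane, `weilClassesOf_sup_nonWeil_eq_top` / `weilClassesOf_inf_nonWeil_eq_bot`,
  given a name), `IsCompl (weilClassesOf A φ n d) (mixedPart A φ n d)` and the PROJECTOR `weilPlaneProj : H²ⁿ →ₗ[ℂ] H²ⁿ`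
  onto `W_K` along `W'` (Mathlib `Submodule.projection`), with its calculus.
* §12.2 **RATIONAL DESCENT** (the one theorem with content): `exists_ratPoly_weilPlaneProjector` — there are `x₀ ≥ 1` and a
  polynomial `Π ∈ ℚ[X]` (RATIONAL coefficients) with `Π(ψ_{x₀}^*) = id` on `W_K` and `= 0` on `W'`, where
  `ψ_{x₀} = x₀·𝟙 + φ` is the tree's separating test isogeny (`exists_pos_nat_separating_weilCharacters`). Construction:
  with `α, β = x₀ ± i√d` (so `αβ = x₀² + d ∈ ℕ`, `αᵏ + βᵏ ∈ ℤ`, tree lemmas `add_mul_sub_eq_of_sq_eq`,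
  `exists_int_eq_pow_add_pow`) the Weil quadratic `m = (X − α²ⁿ)(X − β²ⁿ)` and the mixed quadratics
  `Q_a = (X − αᵃβ²ⁿ⁻ᵃ)(X − α²ⁿ⁻ᵃβᵃ)` (`1 ≤ a ≤ n`) have rational coefficients (Vieta), `m` is coprime to `g = ∏ Q_a`
  over `ℂ` (separation) hence over `ℚ` (`Polynomial.isCoprime_map`), and Bezout `u·m + v·g = 1` in `ℚ[X]` gives
  `Π = v·g`. Consequences: `weilPlaneProj = Π(ψ_{x₀}^*)` (`exists_ratPoly_eq_weilPlaneProj`), hence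
  **`isRationalClass_weilPlaneProj`: the Weil part of a RATIONAL class is RATIONAL** (and so is its mixed part) — i.e. the
  decomposition `H²ⁿ = W_K ⊕ W'` is defined over `ℚ` (van Geemen 4.9–4.11 / Deligne–Milne §4: `W_K` is a `ℚ`-sub-Hodge
  structure cut out by the `K`-action), here with an EXPLICIT rational idempotent in `ℚ[ψ_{x₀}^*]`.
* §12.3 RATIONAL COORDINATES: in any rational `ℂ`-independent pair `r₁, r₂ ∈ W_K` (`dim A = 2n`, so `dim W_K = 2`,
  tree `finrank_weilClassesOf_eq_two`) every RATIONAL `w ∈ W_K` has RATIONAL coordinates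
  (`exists_rat_coords_of_frame`, via `linearIndependent_iff_of_isRationalClass`); at the anchor, for a `WeilFrame`
  (v4) and ANY rational class `c ∈ H⁸(S⁴)`: `N • weilPlaneProj c = wOf μ` for some `N ≥ 1`, `μ ∈ ℤ[i]`
  (`WeilFrame.exists_nsmul_weilPlaneProj_eq_wOf`) — the design's `μ` is READ OFF the class, up to the scale `N`.
* §12.4 THE FRAME-FREE CHECKS at the anchor `(S⁴ = pad4Anchor E₀, ψ = pad4Action E₀ ψ₀, n = 4, d = 1)`:
  `HasWeilPart ψ₀ c :↔ c ∉ W'₈` ((σ)∘ on a class; `↔ weilPlaneProj₈ c ≠ 0` `↔` the tree's Weil-visibility certificate);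
  `MixedPartInLine hψ h c :↔ ∃ q : ℚ, c − weilPlaneProj₈ c = q • h⁴` ((A1@Z)∘ on a class); `ClassCheckFree hψ h i`
  ((σ)∘ ∧ (A1@Z)∘ for SOME rational class supported on the seed `i : Z ↪ S⁴`); `CleanAtSeedFree C I hψ h 𝓔` (sheaf door).
  LINKS TO v4: `ClassCheck K μ i q → h_K⁴ ∈ W'₈ → ClassCheckFree` and CONVERSELY
  `ClassCheckFree → ∃ μ q, ClassCheck K μ i q` (`dim E₀ = 1`); `CleanAtSeed → CleanAtSeedFree` and
  `CleanAtSeedFree → ∃ N μ q, N • ch₄(𝓔) = q • h⁴ + wOf μ` for vector bundles. So v4's frame-dependent (σ)/(A1@Z) and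
  the frame-free ones agree up to the scale `(N, μ) ~ (1, μ/N)`: **the frame and the design only NAME `μ`; the checks
  themselves are properties of the supported rational classes of `Z` (resp. of `ch(𝓔)`) alone.**

FLAGS (C5–C8 audit, cumulative with v4 §4 / v8): (σ) is NOT implied by C0–C4 as a check on an undesigned `cl(Z)` or
`c₄(𝓔)` — it is a genuine, now frame-free and period-free, linear-algebra test (`Π(ψ_{x₀}^*) c ≠ 0`); its DESIGN
shadow on stub-shaped classes `q·h_K⁴ + wOf μ` is exactly C0's `μ ≠ 0` (`hasWeilPart_smul_cupPowTwo_add_wOf_iff`,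
modulo `h_K⁴ ∈ W'₈`, which v8 proved for every `(e, a)` and is kept here as a hypothesis because v8 is not importable).
«`μ ∈ ℤ[i]`» is a normalisation, not a constraint: every rational class has `W`-coordinate in `ℚ(i)·frame`
(`exists_nsmul_weilPlaneProj_eq_wOf`). pad4-compatibility and disc-one enter only through the types
(`pad4Anchor`, `pad4Action_comp_self`, `d = 1`); §12.1–§12.3 hold for every `d ≥ 1`, `n ≥ 1`.

Imports: v4 + `WeilCharacterDecomposition` only (as v8). No `sorry`, no new axiom, no `instance`, no `notation`.
-/

noncomputable section

set_option linter.dupNamespace false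

open CategoryTheory AlgebraicGeometry
open Literature.AlgebraicGeometry Literature.AlgebraicGeometry.Motives Literature.AlgebraicGeometry.HodgeTheory
open Literature.AlgebraicTopology.SingularHomology

namespace Summit.HodgeConjecture.HodgeConjecture.Cruxes.BlochSeedDiscOne.SeedChecker

open Summit.HodgeConjecture.HodgeConjecture.Cruxes.BlochSeedDiscOne.Anchor
open Summit.Ventures.HSemireg Summit.Ventures.HSemireg.Pad4Tower

/-! ## §12.1 The mixed part `W'` and the projector onto the Weil plane (generic `(A, φ)`, `φ² = −d`) -/

section MixedPart

open Polynomial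

variable {A : AbelianVariety ℂ} {n d : ℕ}

/-- **The mixed part** `W' = ⊕_{a+b=2n, a ≥ 1, b ≥ 1} χ_{a,b}` of `H²ⁿ(A(ℂ); ℂ)`: the sum of the test-isogeny
eigenclass spaces of the mixed characters (van Geemen 6.12's `∧ᵃ V₊ ⊗ ∧ᵇ V₋`, `a, b ≥ 1`) — the complement of the
Weil plane `W_K = χ_{2n,0} ⊕ χ_{0,2n} = weilClassesOf A φ n d`. Literally the tree's `⨆` in
`weilClassesOf_sup_nonWeil_eq_top`. [cite: vanGeemen1994HodgeAV, 6.11–6.12] -/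
def mixedPart (A : AbelianVariety ℂ) (φ : A ⟶ A) (n d : ℕ) : Submodule ℂ (complexBetti A.X (2 * n)) :=
  ⨆ (a : ℕ) (b : ℕ) (_ : a + b = 2 * n) (_ : 0 < a) (_ : 0 < b),
    pullbackEigenclasses A φ (2 * n) (fun x y =>
      ((x : ℂ) + (y : ℂ) * Complex.I * (Real.sqrt d : ℂ)) ^ a *
        ((x : ℂ) - (y : ℂ) * Complex.I * (Real.sqrt d : ℂ)) ^ b)

theorem pullbackEigenclasses_le_mixedPart (φ : A ⟶ A) {a b : ℕ} (hab : a + b = 2 * n) (ha : 0 < a)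
    (hb : 0 < b) :
    pullbackEigenclasses A φ (2 * n) (fun x y =>
        ((x : ℂ) + (y : ℂ) * Complex.I * (Real.sqrt d : ℂ)) ^ a *
          ((x : ℂ) - (y : ℂ) * Complex.I * (Real.sqrt d : ℂ)) ^ b) ≤ mixedPart A φ n d :=
  le_iSup_of_le a (le_iSup_of_le b (le_iSup_of_le hab (le_iSup_of_le ha (le_iSup_of_le hb le_rfl))))

/-- the balanced character space `χ_{n,n}` (home of `ℚ[divisors]` in degree `2n`, v8 §11) lies in `W'`. -/
theorem balanced_le_mixedPart (φ : A ⟶ A) (hn : 0 < n) :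
    pullbackEigenclasses A φ (2 * n) (fun x y =>
        ((x : ℂ) + (y : ℂ) * Complex.I * (Real.sqrt d : ℂ)) ^ n *
          ((x : ℂ) - (y : ℂ) * Complex.I * (Real.sqrt d : ℂ)) ^ n) ≤ mixedPart A φ n d :=
  pullbackEigenclasses_le_mixedPart φ (two_mul n).symm hn hn

theorem weilClassesOf_sup_mixedPart (hd : 0 < d) {φ : A ⟶ A} (hφ : φ ≫ φ = -(d • 𝟙 A)) :
    weilClassesOf A φ n d ⊔ mixedPart A φ n d = ⊤ :=
  weilClassesOf_sup_nonWeil_eq_top hd hφ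

theorem weilClassesOf_inf_mixedPart (hn : 0 < n) (hd : 0 < d) (φ : A ⟶ A) :
    weilClassesOf A φ n d ⊓ mixedPart A φ n d = ⊥ :=
  weilClassesOf_inf_nonWeil_eq_bot hn hd φ

/-- `H²ⁿ = W_K ⊕ W'`. -/
theorem isCompl_weilClassesOf_mixedPart (hn : 0 < n) (hd : 0 < d) {φ : A ⟶ A}
    (hφ : φ ≫ φ = -(d • 𝟙 A)) : IsCompl (weilClassesOf A φ n d) (mixedPart A φ n d) :=
  IsCompl.of_eq (weilClassesOf_inf_mixedPart hn hd φ) (weilClassesOf_sup_mixedPart hd hφ)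

theorem exists_weil_add_mixed (hd : 0 < d) {φ : A ⟶ A} (hφ : φ ≫ φ = -(d • 𝟙 A))
    (c : complexBetti A.X (2 * n)) :
    ∃ w ∈ weilClassesOf A φ n d, ∃ b ∈ mixedPart A φ n d, c = w + b := by
  have h : c ∈ weilClassesOf A φ n d ⊔ mixedPart A φ n d := by
    rw [weilClassesOf_sup_mixedPart hd hφ]; exact Submodule.mem_top
  obtain ⟨w, hw, b, hb, hwb⟩ := Submodule.mem_sup.mp h
  exact ⟨w, hw, b, hb, hwb.symm⟩

/-- `W'` is stable under every polynomial in every test pull-back. -/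
theorem aeval_map_mem_mixedPart {φ : A ⟶ A} (x y : ℕ) (p : ℂ[X]) {s : complexBetti A.X (2 * n)}
    (hs : s ∈ mixedPart A φ n d) :
    aeval (complexBetti.map (x • 𝟙 A + y • φ).hom.hom.hom (2 * n)).hom p s ∈ mixedPart A φ n d :=
  aeval_map_mem_nonWeil x y p hs

/-- the tree's Weil-visibility certificate, restated over `mixedPart`: `s ∉ W'` iff some polynomial in some test
pull-back moves `s` to a non-zero Weil class. -/
theorem weilVisible_iff_not_mem_mixedPart (hn : 0 < n) (hd : 0 < d) {φ : A ⟶ A}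
    (hφ : φ ≫ φ = -(d • 𝟙 A)) (s : complexBetti A.X (2 * n)) :
    (∃ (x y : ℕ) (p : ℂ[X]), 0 < x ∧
        aeval (complexBetti.map (x • 𝟙 A + y • φ).hom.hom.hom (2 * n)).hom p s ∈ weilClassesOf A φ n d ∧
          aeval (complexBetti.map (x • 𝟙 A + y • φ).hom.hom.hom (2 * n)).hom p s ≠ 0) ↔
      s ∉ mixedPart A φ n d :=
  weilVisible_iff_not_mem_nonWeil hn hd hφ s

/-- **The projector `π_W : H²ⁿ → H²ⁿ` onto the Weil plane along the mixed part.** -/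
def weilPlaneProj (hn : 0 < n) (hd : 0 < d) {φ : A ⟶ A} (hφ : φ ≫ φ = -(d • 𝟙 A)) :
    complexBetti A.X (2 * n) →ₗ[ℂ] complexBetti A.X (2 * n) :=
  (weilClassesOf A φ n d).projection (mixedPart A φ n d) (isCompl_weilClassesOf_mixedPart hn hd hφ)

variable (hn : 0 < n) (hd : 0 < d) {φ : A ⟶ A} (hφ : φ ≫ φ = -(d • 𝟙 A))

theorem weilPlaneProj_mem (c : complexBetti A.X (2 * n)) : weilPlaneProj hn hd hφ c ∈ weilClassesOf A φ n d :=
  Submodule.projection_apply_mem _ c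

theorem sub_weilPlaneProj_mem (c : complexBetti A.X (2 * n)) : c - weilPlaneProj hn hd hφ c ∈ mixedPart A φ n d :=
  Submodule.sub_projection_mem _ c

theorem weilPlaneProj_apply_of_mem {w : complexBetti A.X (2 * n)} (hw : w ∈ weilClassesOf A φ n d) :
    weilPlaneProj hn hd hφ w = w :=
  Submodule.projection_apply_of_mem_left _ hw

theorem weilPlaneProj_eq_zero_iff {c : complexBetti A.X (2 * n)} :
    weilPlaneProj hn hd hφ c = 0 ↔ c ∈ mixedPart A φ n d :=
  Submodule.projection_apply_eq_zero_iff _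

theorem weilPlaneProj_ne_zero_iff {c : complexBetti A.X (2 * n)} :
    weilPlaneProj hn hd hφ c ≠ 0 ↔ c ∉ mixedPart A φ n d :=
  not_congr (weilPlaneProj_eq_zero_iff hn hd hφ)

theorem weilPlaneProj_apply_of_mem_mixedPart {b : complexBetti A.X (2 * n)} (hb : b ∈ mixedPart A φ n d) :
    weilPlaneProj hn hd hφ b = 0 :=
  (weilPlaneProj_eq_zero_iff hn hd hφ).mpr hb

theorem weilPlaneProj_add_of_mem {w b : complexBetti A.X (2 * n)} (hw : w ∈ weilClassesOf A φ n d)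
    (hb : b ∈ mixedPart A φ n d) : weilPlaneProj hn hd hφ (w + b) = w := by
  rw [map_add, weilPlaneProj_apply_of_mem hn hd hφ hw, weilPlaneProj_apply_of_mem_mixedPart hn hd hφ hb, add_zero]

theorem weilPlaneProj_add_of_mem' {b w : complexBetti A.X (2 * n)} (hb : b ∈ mixedPart A φ n d)
    (hw : w ∈ weilClassesOf A φ n d) : weilPlaneProj hn hd hφ (b + w) = w := by
  rw [add_comm, weilPlaneProj_add_of_mem hn hd hφ hw hb]

theorem weilPlaneProj_eq_of_sub_mem {c w : complexBetti A.X (2 * n)} (hw : w ∈ weilClassesOf A φ n d)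
    (hb : c - w ∈ mixedPart A φ n d) : weilPlaneProj hn hd hφ c = w := by
  rw [show c = w + (c - w) from (add_sub_cancel w c).symm]
  exact weilPlaneProj_add_of_mem hn hd hφ hw hb

theorem weilPlaneProj_weilPlaneProj (c : complexBetti A.X (2 * n)) :
    weilPlaneProj hn hd hφ (weilPlaneProj hn hd hφ c) = weilPlaneProj hn hd hφ c :=
  weilPlaneProj_apply_of_mem hn hd hφ (weilPlaneProj_mem hn hd hφ c)

include hn hd hφ in
/-- uniqueness of the `W_K ⊕ W'` coordinates. -/
theorem eq_of_weil_add_mixed_eq {w w' b b' : complexBetti A.X (2 * n)} (hw : w ∈ weilClassesOf A φ n d)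
    (hw' : w' ∈ weilClassesOf A φ n d) (hb : b ∈ mixedPart A φ n d) (hb' : b' ∈ mixedPart A φ n d)
    (h : w + b = w' + b') : w = w' ∧ b = b' := by
  have h1 : w = w' := by
    have e := weilPlaneProj_add_of_mem hn hd hφ hw hb
    rw [h, weilPlaneProj_add_of_mem hn hd hφ hw' hb'] at e
    exact e.symm
  refine ⟨h1, ?_⟩
  rw [h1] at h
  exact add_left_cancel h

/-! ## §12.2 Rational descent: `π_W` is a RATIONAL polynomial in a test pull-back -/

/-- Vieta over `ℚ → ℂ`: `X² − sX + p ↦ (X − u)(X − v)` when `s = u + v`, `p = uv`. -/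
private theorem map_quadratic_eq_mul_of_vieta {u v : ℂ} {s p : ℚ} (hs : (s : ℂ) = u + v)
    (hp : (p : ℂ) = u * v) :
    (X ^ 2 - C s * X + C p : ℚ[X]).map (algebraMap ℚ ℂ) = (X - C u) * (X - C v) := by
  have hs' : algebraMap ℚ ℂ s = u + v := by rw [eq_ratCast]; exact hs
  have hp' : algebraMap ℚ ℂ p = u * v := by rw [eq_ratCast]; exact hp
  rw [Polynomial.map_add, Polynomial.map_sub, Polynomial.map_mul, Polynomial.map_pow, map_X, map_C, map_C,
    hs', hp', C_add, C_mul]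
  ring

private theorem isCoprime_quadratic_X_sub_C {a b u : ℂ} (ha : u ≠ a) (hb : u ≠ b) :
    IsCoprime ((X - C a) * (X - C b)) (X - C u) :=
  IsCoprime.mul_left (isCoprime_X_sub_C_of_isUnit_sub (Ne.isUnit (sub_ne_zero.mpr (Ne.symm ha))))
    (isCoprime_X_sub_C_of_isUnit_sub (Ne.isUnit (sub_ne_zero.mpr (Ne.symm hb))))

/-- `M(f^*) c` is rational for a rational class `c` and `M ∈ ℚ[X]` (re-proved here; the tree's
`isRationalClass_aeval_hom_complexBetti_map` lives in an unimported file). -/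
private theorem isRationalClass_aeval_ratPoly {Y : SchemeOver ℂ} (f : Y ⟶ Y) {k : ℕ} (M : ℚ[X])
    {c : complexBetti Y k} (hc : IsRationalClass c) :
    IsRationalClass (aeval (complexBetti.map f k).hom (M.map (algebraMap ℚ ℂ)) c) := by
  rw [Polynomial.aeval_eq_sum_range, LinearMap.sum_apply]
  have hpow : ∀ j : ℕ, IsRationalClass (((complexBetti.map f k).hom ^ j) c) := by
    intro j
    induction j with
    | zero => simpa using hc
    | succ j ih =>
        rw [pow_succ', Module.End.mul_apply]
        exact isRationalClass_complexBetti_map f ih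
  have hterm : ∀ j ∈ Finset.range ((M.map (algebraMap ℚ ℂ)).natDegree + 1),
      ((M.map (algebraMap ℚ ℂ)).coeff j • (complexBetti.map f k).hom ^ j) c =
        (((M.coeff j : ℚ)) : ℂ) • ((complexBetti.map f k).hom ^ j) c := by
    intro j _
    rw [LinearMap.smul_apply, Polynomial.coeff_map, eq_ratCast]
  rw [Finset.sum_congr rfl hterm]
  exact IsRationalClass.sum_smul _ hpow _

/-- **THE RATIONAL WEIL PROJECTOR.** For any `(A, φ, n)` and `d ≥ 1` (no hypothesis on `φ` is needed to STATE it;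
under `φ ≫ φ = -(d • 𝟙 A)` the two spaces are complementary, §12.1) there are `x₀ ≥ 1` and `Π ∈ ℚ[X]`
with `Π(ψ_{x₀}^*) = id` on the Weil plane `W_K` and `Π(ψ_{x₀}^*) = 0` on the mixed part `W'`, `ψ_{x₀} = x₀·𝟙 + φ`. (Vieta + separation + Bezout in `ℚ[X]`; see the module docstring.)
[cite: vanGeemen1994HodgeAV, 4.9–4.11 and 6.12] [cite: Deligne1982HodgeCycles, §4] -/
theorem exists_ratPoly_weilPlaneProjector (n : ℕ) (hd : 0 < d) (φ : A ⟶ A) :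
    ∃ (x₀ : ℕ) (P : ℚ[X]), 0 < x₀ ∧
      (∀ w ∈ weilClassesOf A φ n d,
        aeval (complexBetti.map (x₀ • 𝟙 A + (1 : ℕ) • φ).hom.hom.hom (2 * n)).hom
          (P.map (algebraMap ℚ ℂ)) w = w) ∧
      (∀ b ∈ mixedPart A φ n d,
        aeval (complexBetti.map (x₀ • 𝟙 A + (1 : ℕ) • φ).hom.hom.hom (2 * n)).hom
          (P.map (algebraMap ℚ ℂ)) b = 0) := by
  classical
  obtain ⟨x₀, hx₀, hsep⟩ := exists_pos_nat_separating_weilCharacters hd (2 * n)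
  -- the two eigenvalues `α = x₀ + i√d`, `β = x₀ − i√d` of `ψ_{x₀}^*` on `H¹`
  set ν : ℂ := ((1 : ℕ) : ℂ) * Complex.I * (Real.sqrt d : ℂ) with hν
  set α : ℂ := (x₀ : ℂ) + ν with hα
  set β : ℂ := (x₀ : ℂ) - ν with hβ
  have hν2 : ν ^ 2 = -(d : ℂ) := by rw [hν, Nat.cast_one, one_mul]; exact I_mul_sqrt_sq d
  -- integrality: `αβ = N ∈ ℚ`, `αᵏ + βᵏ = z k ∈ ℤ`
  obtain ⟨N, hN⟩ : ∃ N : ℚ, α * β = (N : ℂ) := ⟨_, add_mul_sub_eq_of_sq_eq x₀ d hν2⟩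
  have hzex : ∀ k : ℕ, ∃ z : ℤ, α ^ k + β ^ k = (z : ℂ) := fun k => exists_int_eq_pow_add_pow x₀ d hν2 k
  choose z hz using hzex
  -- the Weil quadratic `m = (X − α²ⁿ)(X − β²ⁿ)` and the mixed product `g = ∏_{a=1}^{n} (X − αᵃβ²ⁿ⁻ᵃ)(X − α²ⁿ⁻ᵃβᵃ)`,
  -- both with RATIONAL coefficients
  set m : ℚ[X] := X ^ 2 - C ((z (2 * n) : ℚ)) * X + C (N ^ (2 * n)) with hmdef
  set g : ℚ[X] := ∏ a ∈ Finset.Icc 1 n,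
    (X ^ 2 - C (N ^ a * (z (2 * n - 2 * a) : ℚ)) * X + C (N ^ (2 * n))) with hgdef
  have hm : m.map (algebraMap ℚ ℂ) = (X - C (α ^ (2 * n))) * (X - C (β ^ (2 * n))) := by
    rw [hmdef]
    apply map_quadratic_eq_mul_of_vieta
    · push_cast; exact (hz (2 * n)).symm
    · push_cast; rw [← hN, mul_pow]
  have hQ : ∀ a ∈ Finset.Icc 1 n,
      (X ^ 2 - C (N ^ a * (z (2 * n - 2 * a) : ℚ)) * X + C (N ^ (2 * n)) : ℚ[X]).map (algebraMap ℚ ℂ) =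
        (X - C (α ^ a * β ^ (2 * n - a))) * (X - C (α ^ (2 * n - a) * β ^ a)) := by
    intro a ha
    obtain ⟨ha1, han⟩ := Finset.mem_Icc.mp ha
    obtain ⟨c, hc⟩ : ∃ c, 2 * n - a = a + c := ⟨2 * n - 2 * a, by omega⟩
    have hc' : 2 * n - 2 * a = c := by omega
    apply map_quadratic_eq_mul_of_vieta
    · push_cast
      rw [hc', ← hz c, ← hN, hc, pow_add, pow_add]
      ring
    · push_cast
      rw [← hN]
      have e : (α * β) ^ (2 * n) = (α * β) ^ a * (α * β) ^ (2 * n - a) := by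
        rw [← pow_add]; congr 1; omega
      rw [e, mul_pow, mul_pow]
      ring
  -- coprimality over `ℂ` (separation of the characters), descended to `ℚ`
  have hcopC : IsCoprime (m.map (algebraMap ℚ ℂ)) (g.map (algebraMap ℚ ℂ)) := by
    rw [hm, hgdef, Polynomial.map_prod]
    refine IsCoprime.prod_right fun a ha => ?_
    rw [hQ a ha]
    obtain ⟨ha1, han⟩ := Finset.mem_Icc.mp ha
    obtain ⟨h1, h2⟩ := hsep a (2 * n - a) (by omega) (by omega) (by omega)
    obtain ⟨h3, h4⟩ := hsep (2 * n - a) a (by omega) (by omega) (by omega)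
    exact IsCoprime.mul_right (isCoprime_quadratic_X_sub_C h1 h2) (isCoprime_quadratic_X_sub_C h3 h4)
  obtain ⟨u, v, huv⟩ := (Polynomial.isCoprime_map (algebraMap ℚ ℂ)).mp hcopC
  -- `Π := v·g`: value `1` at the Weil characters (Bezout), value `0` at the mixed ones
  have hone : ∀ ρ : ℂ, (m.map (algebraMap ℚ ℂ)).eval ρ = 0 →
      ((v * g).map (algebraMap ℚ ℂ)).eval ρ = 1 := by
    intro ρ hρ
    have h := congrArg (fun P : ℚ[X] => (P.map (algebraMap ℚ ℂ)).eval ρ) huv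
    simp only [Polynomial.map_add, Polynomial.map_mul, Polynomial.map_one, eval_add, eval_mul, eval_one,
      hρ, mul_zero, zero_add] at h
    rw [Polynomial.map_mul, eval_mul]
    exact h
  have hmα : (m.map (algebraMap ℚ ℂ)).eval (α ^ (2 * n)) = 0 := by
    simp only [hm, eval_mul, eval_sub, eval_X, eval_C, sub_self, zero_mul]
  have hmβ : (m.map (algebraMap ℚ ℂ)).eval (β ^ (2 * n)) = 0 := by
    simp only [hm, eval_mul, eval_sub, eval_X, eval_C, sub_self, mul_zero]
  have hzero : ∀ a b : ℕ, a + b = 2 * n → 0 < a → 0 < b →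
      ((v * g).map (algebraMap ℚ ℂ)).eval (α ^ a * β ^ b) = 0 := by
    intro a b hab ha hb
    rw [Polynomial.map_mul, eval_mul, hgdef, Polynomial.map_prod, eval_prod]
    apply mul_eq_zero_of_right
    rcases le_or_gt a n with han | hna
    · have haI : a ∈ Finset.Icc 1 n := Finset.mem_Icc.mpr ⟨ha, han⟩
      apply Finset.prod_eq_zero haI
      rw [hQ a haI, show 2 * n - a = b by omega]
      simp only [eval_mul, eval_sub, eval_X, eval_C, sub_self, zero_mul]
    · have hbI : b ∈ Finset.Icc 1 n := Finset.mem_Icc.mpr ⟨hb, by omega⟩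
      apply Finset.prod_eq_zero hbI
      rw [hQ b hbI, show 2 * n - b = a by omega]
      simp only [eval_mul, eval_sub, eval_X, eval_C, sub_self, mul_zero]
  refine ⟨x₀, v * g, hx₀, ?_, ?_⟩
  · -- on `W_K = E₊ ⊕ E₋`
    intro w hw
    obtain ⟨w₁, h₁, w₂, h₂, rfl⟩ := Submodule.mem_sup.mp hw
    have k₁ := hone _ hmα
    have k₂ := hone _ hmβ
    rw [hα, hν] at k₁
    rw [hβ, hν] at k₂
    rw [aeval_map_add_of_mem_weilClasses x₀ 1 _ h₁ h₂, k₁, k₂, one_smul, one_smul]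
  · -- on `W'`: every mixed summand is an eigenspace of `ψ_{x₀}^*` for a root of `g`
    have hle : mixedPart A φ n d ≤ LinearMap.ker
        (aeval (complexBetti.map (x₀ • 𝟙 A + (1 : ℕ) • φ).hom.hom.hom (2 * n)).hom
          ((v * g).map (algebraMap ℚ ℂ))) :=
      iSup_le fun a => iSup_le fun b => iSup_le fun hab => iSup_le fun ha => iSup_le fun hb => by
        intro s hs
        rw [LinearMap.mem_ker]
        have hs' := pullbackEigenclasses_le_eigenspace φ (2 * n) _ x₀ 1 hs
        by_cases h0 : s = 0
        · rw [h0, map_zero]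
        · have key := hzero a b hab ha hb
          rw [hα, hβ, hν] at key
          rw [Module.End.aeval_apply_of_hasEigenvector ⟨hs', h0⟩]
          simp only [key, zero_smul]
    intro b hb
    exact LinearMap.mem_ker.mp (hle hb)

/-- **`π_W` IS A RATIONAL POLYNOMIAL IN A TEST PULL-BACK.** -/
theorem exists_ratPoly_eq_weilPlaneProj :
    ∃ (x₀ : ℕ) (P : ℚ[X]), 0 < x₀ ∧ ∀ c : complexBetti A.X (2 * n),
      aeval (complexBetti.map (x₀ • 𝟙 A + (1 : ℕ) • φ).hom.hom.hom (2 * n)).hom (P.map (algebraMap ℚ ℂ)) c =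
        weilPlaneProj hn hd hφ c := by
  obtain ⟨x₀, P, hx₀, hW, hW'⟩ := exists_ratPoly_weilPlaneProjector n hd φ
  refine ⟨x₀, P, hx₀, fun c => ?_⟩
  obtain ⟨w, hw, b, hb, rfl⟩ := exists_weil_add_mixed hd hφ c
  rw [map_add, hW w hw, hW' b hb, add_zero, weilPlaneProj_add_of_mem hn hd hφ hw hb]

/-- **RATIONAL DESCENT: the Weil part of a rational class is rational.** -/
theorem isRationalClass_weilPlaneProj {c : complexBetti A.X (2 * n)} (hc : IsRationalClass c) :
    IsRationalClass (weilPlaneProj hn hd hφ c) := by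
  obtain ⟨x₀, P, -, h⟩ := exists_ratPoly_eq_weilPlaneProj hn hd hφ
  rw [← h c]
  exact isRationalClass_aeval_ratPoly _ P hc

/-- … and so is its mixed part. -/
theorem isRationalClass_sub_weilPlaneProj {c : complexBetti A.X (2 * n)} (hc : IsRationalClass c) :
    IsRationalClass (c - weilPlaneProj hn hd hφ c) := by
  have h := hc.add ((isRationalClass_weilPlaneProj hn hd hφ hc).smul (-1 : ℚ))
  rwa [Rat.cast_neg, Rat.cast_one, neg_one_smul, ← sub_eq_add_neg] at h

/-- `W_K` is spanned by its rational classes in the strong sense that `π_W` maps rational classes ONTO the rational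
classes of `W_K` (every rational `w ∈ W_K` is its own image). -/
theorem isRationalClass_and_mem_weilClassesOf_iff (w : complexBetti A.X (2 * n)) :
    (IsRationalClass w ∧ w ∈ weilClassesOf A φ n d) ↔
      ∃ c : complexBetti A.X (2 * n), IsRationalClass c ∧ weilPlaneProj hn hd hφ c = w := by
  constructor
  · rintro ⟨hq, hw⟩
    exact ⟨w, hq, weilPlaneProj_apply_of_mem hn hd hφ hw⟩
  · rintro ⟨c, hc, rfl⟩
    exact ⟨isRationalClass_weilPlaneProj hn hd hφ hc, weilPlaneProj_mem hn hd hφ c⟩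

/-! ## §12.3 Rational coordinates in a rational frame of the Weil plane -/

include hn hd hφ in
/-- **rational classes of `W_K` have rational coordinates in any rational `ℂ`-independent pair of `W_K`**
(`dim A = 2n`, so `dim_ℂ W_K = 2` and the pair is a basis; a `ℂ`-relation among rational classes is a `ℚ`-relation). -/
theorem exists_rat_coords_of_frame (hA : A.dim = 2 * n) {r₁ r₂ w : complexBetti A.X (2 * n)}
    (h₁ : r₁ ∈ weilClassesOf A φ n d) (h₂ : r₂ ∈ weilClassesOf A φ n d)
    (h₁q : IsRationalClass r₁) (h₂q : IsRationalClass r₂)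
    (hind : ∀ s t : ℂ, s • r₁ + t • r₂ = 0 → s = 0 ∧ t = 0)
    (hw : w ∈ weilClassesOf A φ n d) (hwq : IsRationalClass w) :
    ∃ s t : ℚ, w = (s : ℂ) • r₁ + (t : ℂ) • r₂ := by
  classical
  -- (1) `W_K = span {r₁, r₂}`
  haveI := finite_complexBetti_abelianVariety A (2 * n)
  have h2 : Module.finrank ℂ (weilClassesOf A φ n d) = 2 :=
    finrank_weilClassesOf_eq_two (Motives.AbelianVariety.hasExteriorCohomologyH1_complexPoints A)
      (by rw [Motives.AbelianVariety.finrank_complexBetti_one, hA]) hn hd hφ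
  have hli : LinearIndependent ℂ ![r₁, r₂] := LinearIndependent.pair_iff.mpr hind
  have hle : Submodule.span ℂ (Set.range ![r₁, r₂]) ≤ weilClassesOf A φ n d := by
    rw [Submodule.span_le, Set.range_subset_iff]
    intro i
    fin_cases i
    · exact h₁
    · exact h₂
  have hspan : Submodule.span ℂ (Set.range ![r₁, r₂]) = weilClassesOf A φ n d :=
    Submodule.eq_of_le_of_finrank_eq hle (by rw [finrank_span_eq_card hli, h2, Fintype.card_fin])
  -- (2) complex coordinates
  have hw' : w ∈ Submodule.span ℂ (Set.range ![r₁, r₂]) := by rw [hspan]; exact hw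
  obtain ⟨g, hg⟩ := (Submodule.mem_span_range_iff_exists_fun ℂ).mp hw'
  simp only [Fin.sum_univ_two, Matrix.cons_val_zero, Matrix.cons_val_one] at hg
  -- (3) they are rational: `(w, r₁, r₂)` is a rational `ℂ`-dependent triple, hence `ℚ`-dependent
  have hb : ∀ j, IsRationalClass (![w, r₁, r₂] j) := by
    intro j
    fin_cases j
    · exact hwq
    · exact h₁q
    · exact h₂q
  have hdep : ¬ LinearIndependent ℂ ![w, r₁, r₂] := by
    rw [Fintype.not_linearIndependent_iff]
    refine ⟨![1, -g 0, -g 1], ?_, 0, by simp⟩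
    simp only [Fin.sum_univ_three, Matrix.cons_val_zero, Matrix.cons_val_one, Matrix.cons_val_two,
      Matrix.head_cons, Matrix.tail_cons, one_smul, neg_smul]
    rw [← hg]
    abel
  rw [linearIndependent_iff_of_isRationalClass hb] at hdep
  push Not at hdep
  obtain ⟨q, hq, hq0⟩ := hdep
  simp only [Fin.sum_univ_three, Matrix.cons_val_zero, Matrix.cons_val_one, Matrix.cons_val_two,
    Matrix.head_cons, Matrix.tail_cons] at hq
  have hq0' : q 0 ≠ 0 := by
    intro h0
    apply hq0
    rw [h0, Rat.cast_zero, zero_smul, zero_add] at hq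
    obtain ⟨e1, e2⟩ := hind _ _ hq
    have e1' : q 1 = 0 := by exact_mod_cast e1
    have e2' : q 2 = 0 := by exact_mod_cast e2
    funext j
    fin_cases j
    · exact h0
    · exact e1'
    · exact e2'
  have hq0c : ((q 0 : ℚ) : ℂ) ≠ 0 := by exact_mod_cast hq0'
  rw [← hg] at hq
  have key : ((q 0 : ℂ) * g 0 + (q 1 : ℂ)) • r₁ + ((q 0 : ℂ) * g 1 + (q 2 : ℂ)) • r₂ = 0 := by
    rw [← hq, smul_add, smul_smul, smul_smul, add_smul, add_smul]
    abel
  obtain ⟨e1, e2⟩ := hind _ _ key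
  refine ⟨-(q 1 / q 0), -(q 2 / q 0), ?_⟩
  have hg0 : g 0 = ((-(q 1 / q 0) : ℚ) : ℂ) := by
    push_cast
    field_simp
    linear_combination e1
  have hg1 : g 1 = ((-(q 2 / q 0) : ℚ) : ℂ) := by
    push_cast
    field_simp
    linear_combination e2
  rw [← hg, ← hg0, ← hg1]

private theorem exists_nat_mul_rat_eq_int (s t : ℚ) :
    ∃ (N : ℕ) (a b : ℤ), 0 < N ∧ (N : ℚ) * s = a ∧ (N : ℚ) * t = b := by
  refine ⟨s.den * t.den, s.num * t.den, t.num * s.den, Nat.mul_pos s.den_pos t.den_pos, ?_, ?_⟩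
  · push_cast
    calc (s.den : ℚ) * t.den * s = (s * s.den) * t.den := by ring
      _ = s.num * t.den := by rw [Rat.mul_den_eq_num]
  · push_cast
    calc (s.den : ℚ) * t.den * t = (t * t.den) * s.den := by ring
      _ = t.num * s.den := by rw [Rat.mul_den_eq_num]

end MixedPart

/-! ## §12.4 The anchor `(S⁴, ψ, n = 4, d = 1)`: (σ) and (A1@Z) on a CLASS, frame-free; links to v4 -/

section AnchorDescent

variable {E₀ : AbelianVariety ℂ} {ψ₀ : E₀ ⟶ E₀}

private theorem four_pos₉ : (0 : ℕ) < 4 := by norm_num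

/-- `W'₈(S⁴)`, the mixed part of `H⁸` of the pad-4 anchor (`χ₄₄ ⊕ ⊕_{a ≠ b} χ_{a,b}`; contains `ℚ[divisors]₈`, v8). -/
abbrev mixedPart₈ (E₀ : AbelianVariety ℂ) (ψ₀ : E₀ ⟶ E₀) : Submodule ℂ (complexBetti (pad4Anchor E₀).X (2 * 4)) :=
  mixedPart (pad4Anchor E₀) (pad4Action E₀ ψ₀) 4 1

/-- `π_W` on `H⁸(S⁴(ℂ); ℂ)`. -/
abbrev weilPlaneProj₈ (hψ : ψ₀ ≫ ψ₀ = -(1 • 𝟙 E₀)) :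
    complexBetti (pad4Anchor E₀).X (2 * 4) →ₗ[ℂ] complexBetti (pad4Anchor E₀).X (2 * 4) :=
  weilPlaneProj (A := pad4Anchor E₀) (n := 4) (d := 1) four_pos₉ Nat.one_pos (pad4Action_comp_self hψ)

/-- the `W_K`-component of ANY rational class of `H⁸(S⁴)` is rational. -/
theorem isRationalClass_weilPlaneProj₈ (hψ : ψ₀ ≫ ψ₀ = -(1 • 𝟙 E₀)) {c : complexBetti (pad4Anchor E₀).X (2 * 4)}
    (hc : IsRationalClass c) : IsRationalClass (weilPlaneProj₈ hψ c) :=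
  isRationalClass_weilPlaneProj _ _ _ hc

/-! ### rational coordinates / the `μ`-readout in a Weil frame (v4 `WeilFrame`, obligation O-W) -/

theorem WeilFrame.exists_rat_coords (hE : E₀.dim = 1) (hψ : ψ₀ ≫ ψ₀ = -(1 • 𝟙 E₀)) (F : WeilFrame E₀ ψ₀)
    {w : complexBetti (pad4Anchor E₀).X (2 * 4)}
    (hw : w ∈ weilClassesOf (pad4Anchor E₀) (pad4Action E₀ ψ₀) 4 1) (hwq : IsRationalClass w) :
    ∃ s t : ℚ, w = (s : ℂ) • F.rOne + (t : ℂ) • F.rTwo :=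
  exists_rat_coords_of_frame four_pos₉ Nat.one_pos (pad4Action_comp_self hψ) (pad4Anchor_dim hE)
    F.rOne_mem F.rTwo_mem F.rOne_rational F.rTwo_rational F.indep hw hwq

/-- every rational Weil class is `(1/N)·wOf μ`, `μ ∈ ℤ[i]`, `N ≥ 1`. -/
theorem WeilFrame.exists_nsmul_eq_wOf (hE : E₀.dim = 1) (hψ : ψ₀ ≫ ψ₀ = -(1 • 𝟙 E₀)) (F : WeilFrame E₀ ψ₀)
    {w : complexBetti (pad4Anchor E₀).X (2 * 4)}
    (hw : w ∈ weilClassesOf (pad4Anchor E₀) (pad4Action E₀ ψ₀) 4 1) (hwq : IsRationalClass w) :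
    ∃ (N : ℕ) (μ : GaussianInt), 0 < N ∧ ((N : ℕ) : ℂ) • w = F.wOf μ := by
  obtain ⟨s, t, rfl⟩ := F.exists_rat_coords hE hψ hw hwq
  obtain ⟨N, a, b, hN, ha, hb⟩ := exists_nat_mul_rat_eq_int s t
  refine ⟨N, ⟨a, b⟩, hN, ?_⟩
  have ha' : ((N : ℕ) : ℂ) * (s : ℂ) = ((a : ℚ) : ℂ) := by exact_mod_cast ha
  have hb' : ((N : ℕ) : ℂ) * (t : ℂ) = ((b : ℚ) : ℂ) := by exact_mod_cast hb
  rw [WeilFrame.wOf, smul_add, smul_smul, smul_smul, ha', hb']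

/-- **THE `μ`-READOUT OF A RATIONAL CLASS**: for ANY rational `c ∈ H⁸(S⁴)` (e.g. `cl(Z)`, `c₄(𝓔)`, `ch₄(𝓔)`),
`N • π_W(c) = wOf μ` for some `N ≥ 1`, `μ ∈ ℤ[i]` — the design datum `μ` is read off the class (up to the scale
`N`), with no period computation. -/
theorem WeilFrame.exists_nsmul_weilPlaneProj_eq_wOf (hE : E₀.dim = 1) (hψ : ψ₀ ≫ ψ₀ = -(1 • 𝟙 E₀))
    (F : WeilFrame E₀ ψ₀) {c : complexBetti (pad4Anchor E₀).X (2 * 4)} (hc : IsRationalClass c) :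
    ∃ (N : ℕ) (μ : GaussianInt), 0 < N ∧ ((N : ℕ) : ℂ) • weilPlaneProj₈ hψ c = F.wOf μ :=
  F.exists_nsmul_eq_wOf hE hψ (weilPlaneProj_mem _ _ _ c) (isRationalClass_weilPlaneProj₈ hψ hc)

theorem WeilFrame.wOf_eq_zero_iff (F : WeilFrame E₀ ψ₀) {μ : GaussianInt} : F.wOf μ = 0 ↔ μ = 0 := by
  refine ⟨fun h => by_contra fun hμ => F.wOf_ne_zero hμ h, fun h => ?_⟩
  rw [h]
  simp only [WeilFrame.wOf, Zsqrtd.re_zero, Zsqrtd.im_zero, Int.cast_zero, Rat.cast_zero, zero_smul, add_zero]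

theorem WeilFrame.weilPlaneProj₈_wOf (hψ : ψ₀ ≫ ψ₀ = -(1 • 𝟙 E₀)) (F : WeilFrame E₀ ψ₀) (μ : GaussianInt) :
    weilPlaneProj₈ hψ (F.wOf μ) = F.wOf μ :=
  weilPlaneProj_apply_of_mem _ _ _ (F.wOf_mem μ)

/-! ### (σ)∘ — the Hodge-class check ON A CLASS -/

/-- **(σ)∘ THE HODGE-CLASS CHECK ON A CLASS `c ∈ H⁸(S⁴(ℂ); ℂ)`, DESIGN-FREE AND FRAME-FREE**: `c` has a non-zero
component in the Weil plane `W_K`, i.e. `c ∉ W'₈ = ⊕_{a+b=8, a,b≥1} χ_{a,b}` («the seed's class is the target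
Weil ∕ non-divisor class, not a divisor polynomial»: `ℚ[divisors]₈ ⊆ χ₄₄ ⊆ W'₈`, v8 §11). For a RATIONAL `c` this is
decided by the rational projector: `Π(ψ_{x₀}^*) c ≠ 0` (`hasWeilPart_iff_weilPlaneProj_ne_zero`, `exists_ratPoly_eq_weilPlaneProj`). -/
def HasWeilPart (ψ₀ : E₀ ⟶ E₀) (c : complexBetti (pad4Anchor E₀).X (2 * 4)) : Prop :=
  c ∉ mixedPart (pad4Anchor E₀) (pad4Action E₀ ψ₀) 4 1

theorem hasWeilPart_iff (ψ₀ : E₀ ⟶ E₀) (c : complexBetti (pad4Anchor E₀).X (2 * 4)) :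
    HasWeilPart ψ₀ c ↔ c ∉ mixedPart₈ E₀ ψ₀ :=
  Iff.rfl

theorem hasWeilPart_iff_weilPlaneProj_ne_zero (hψ : ψ₀ ≫ ψ₀ = -(1 • 𝟙 E₀))
    {c : complexBetti (pad4Anchor E₀).X (2 * 4)} : HasWeilPart ψ₀ c ↔ weilPlaneProj₈ hψ c ≠ 0 :=
  (weilPlaneProj_ne_zero_iff _ _ _).symm

/-- (σ)∘ is the tree's Weil-visibility: some polynomial in some test pull-back moves `c` to a non-zero Weil class. -/
theorem hasWeilPart_iff_weilVisible (hψ : ψ₀ ≫ ψ₀ = -(1 • 𝟙 E₀)) (c : complexBetti (pad4Anchor E₀).X (2 * 4)) :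
    HasWeilPart ψ₀ c ↔ ∃ (x y : ℕ) (p : Polynomial ℂ), 0 < x ∧
      Polynomial.aeval (complexBetti.map (x • 𝟙 (pad4Anchor E₀) + y • pad4Action E₀ ψ₀).hom.hom.hom (2 * 4)).hom
          p c ∈ weilClassesOf (pad4Anchor E₀) (pad4Action E₀ ψ₀) 4 1 ∧
        Polynomial.aeval (complexBetti.map (x • 𝟙 (pad4Anchor E₀) + y • pad4Action E₀ ψ₀).hom.hom.hom (2 * 4)).hom
          p c ≠ 0 :=
  (weilVisible_iff_not_mem_mixedPart four_pos₉ Nat.one_pos (pad4Action_comp_self hψ) c).symm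

theorem hasWeilPart_add_iff (hψ : ψ₀ ≫ ψ₀ = -(1 • 𝟙 E₀)) {b w : complexBetti (pad4Anchor E₀).X (2 * 4)}
    (hb : b ∈ mixedPart₈ E₀ ψ₀) (hw : w ∈ weilClassesOf (pad4Anchor E₀) (pad4Action E₀ ψ₀) 4 1) :
    HasWeilPart ψ₀ (b + w) ↔ w ≠ 0 := by
  rw [hasWeilPart_iff_weilPlaneProj_ne_zero hψ, weilPlaneProj_add_of_mem' _ _ _ hb hw]

/-- **the DESIGN SHADOW of (σ)∘ is C0's `μ ≠ 0`**: on a stub-shaped class `q·h⁴ + wOf μ` with `h⁴ ∈ W'₈` (true for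
every `h = symH ψ e a`, v8 `cupPowTwo_symH_mem_balanced` + `balanced_le_mixedPart`; a hypothesis here),
`HasWeilPart ↔ μ ≠ 0`. -/
theorem hasWeilPart_smul_cupPowTwo_add_wOf_iff (hψ : ψ₀ ≫ ψ₀ = -(1 • 𝟙 E₀)) (F : WeilFrame E₀ ψ₀)
    {h : complexBetti (pad4Anchor E₀).X 2} (hh : cupPowTwo h 4 ∈ mixedPart₈ E₀ ψ₀) (q : ℂ) (μ : GaussianInt) :
    HasWeilPart ψ₀ (q • cupPowTwo h 4 + F.wOf μ) ↔ μ ≠ 0 := by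
  rw [hasWeilPart_add_iff hψ (Submodule.smul_mem _ q hh) (F.wOf_mem μ), Ne, F.wOf_eq_zero_iff]

/-- given `N • π_W c = wOf μ` (`N ≥ 1`, the readout), (σ)∘ on `c` is `μ ≠ 0`. -/
theorem WeilFrame.hasWeilPart_iff_of_nsmul_eq (hψ : ψ₀ ≫ ψ₀ = -(1 • 𝟙 E₀)) (F : WeilFrame E₀ ψ₀)
    {c : complexBetti (pad4Anchor E₀).X (2 * 4)} {N : ℕ} {μ : GaussianInt} (hN : 0 < N)
    (h : ((N : ℕ) : ℂ) • weilPlaneProj₈ hψ c = F.wOf μ) : HasWeilPart ψ₀ c ↔ μ ≠ 0 := by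
  have hN' : ((N : ℕ) : ℂ) ≠ 0 := by exact_mod_cast hN.ne'
  simp only [hasWeilPart_iff_weilPlaneProj_ne_zero hψ, ne_eq]
  rw [← F.wOf_eq_zero_iff, ← h, smul_eq_zero, not_or]
  exact ⟨fun hc => ⟨hN', hc⟩, fun hc => hc.2⟩

/-- **(σ)∘ IS DECIDED BY A RATIONAL POLYNOMIAL IN ONE TEST PULL-BACK**: `HasWeilPart ψ₀ c ↔ Π(ψ_{x₀}^*) c ≠ 0`. -/
theorem exists_ratPoly_hasWeilPart_iff (hψ : ψ₀ ≫ ψ₀ = -(1 • 𝟙 E₀)) :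
    ∃ (x₀ : ℕ) (P : Polynomial ℚ), 0 < x₀ ∧ ∀ c : complexBetti (pad4Anchor E₀).X (2 * 4),
      HasWeilPart ψ₀ c ↔
        Polynomial.aeval (complexBetti.map (x₀ • 𝟙 (pad4Anchor E₀) + (1 : ℕ) • pad4Action E₀ ψ₀).hom.hom.hom
            (2 * 4)).hom (P.map (algebraMap ℚ ℂ)) c ≠ 0 := by
  obtain ⟨x₀, P, hx₀, hP⟩ := exists_ratPoly_eq_weilPlaneProj four_pos₉ Nat.one_pos (pad4Action_comp_self hψ)
  exact ⟨x₀, P, hx₀, fun c => by rw [hasWeilPart_iff_weilPlaneProj_ne_zero hψ, ← hP c]⟩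

/-! ### (A1@Z)∘ — the mixed part on the line `ℚ·h⁴`; the lci door and the sheaf door frame-free; links to v4 -/

/-- **(A1@Z)∘ ON A CLASS** relative to a polarisation class `h ∈ H²(S⁴)`: the mixed (`W'₈`) component of `c` is a
RATIONAL multiple of `h⁴` — `c ∈ ℚ·h⁴ ⊕ W_K`, the degree-`8` clause of v4's `CleanAtSeed` with the frame's `wOf μ`
replaced by `π_W c`. -/
def MixedPartInLine (hψ : ψ₀ ≫ ψ₀ = -(1 • 𝟙 E₀)) (h : complexBetti (pad4Anchor E₀).X 2)
    (c : complexBetti (pad4Anchor E₀).X (2 * 4)) : Prop :=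
  ∃ q : ℚ, c - weilPlaneProj₈ hψ c = ((q : ℚ) : ℂ) • cupPowTwo h 4

theorem MixedPartInLine.exists_eq (hψ : ψ₀ ≫ ψ₀ = -(1 • 𝟙 E₀)) {h : complexBetti (pad4Anchor E₀).X 2}
    {c : complexBetti (pad4Anchor E₀).X (2 * 4)} (hl : MixedPartInLine hψ h c) :
    ∃ q : ℚ, c = ((q : ℚ) : ℂ) • cupPowTwo h 4 + weilPlaneProj₈ hψ c := by
  obtain ⟨q, hq⟩ := hl
  exact ⟨q, by rw [← hq, sub_add_cancel]⟩

/-- a stub-shaped class `q·h⁴ + w` (`w ∈ W_K`, `h⁴ ∈ W'₈`) has its mixed part on the line and Weil part `w`. -/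
theorem mixedPartInLine_of_eq (hψ : ψ₀ ≫ ψ₀ = -(1 • 𝟙 E₀)) {h : complexBetti (pad4Anchor E₀).X 2}
    {c w : complexBetti (pad4Anchor E₀).X (2 * 4)} {q : ℚ} (hh : cupPowTwo h 4 ∈ mixedPart₈ E₀ ψ₀)
    (hw : w ∈ weilClassesOf (pad4Anchor E₀) (pad4Action E₀ ψ₀) 4 1)
    (hc : c = ((q : ℚ) : ℂ) • cupPowTwo h 4 + w) : MixedPartInLine hψ h c ∧ weilPlaneProj₈ hψ c = w := by
  have hπ : weilPlaneProj₈ hψ c = w := by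
    rw [hc]
    exact weilPlaneProj_add_of_mem' _ _ _ (Submodule.smul_mem _ _ hh) hw
  exact ⟨⟨q, by rw [hπ, hc, add_sub_cancel_right]⟩, hπ⟩

/-- **THE lci DOOR, FRAME-FREE — (σ)∘ ∧ (A1@Z)∘ FOR A SEED `i : Z ↪ S⁴`** relative to a polarisation class `h`:
some RATIONAL class supported on `Z` has a non-zero Weil part and its mixed part on the line `ℚ·h⁴` (by purity the
supported rational classes in degree `8 = 2·codim Z` are the rational multiples of `cl(Z)`, so this reads
`cl(Z) = q·h⁴ + w`, `0 ≠ w ∈ W_K` — v4's `ClassCheck` with `wOf μ` replaced by `w = π_W cl(Z)`: no design, no frame,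
no period; (pencil) for `Z = Z(s)`, `[Z(s)] = c₄(𝓔(tH))` (Fulton 14.1) and `w = π_W c₄(𝓔)`). -/
def ClassCheckFree (hψ : ψ₀ ≫ ψ₀ = -(1 • 𝟙 E₀)) (h : complexBetti (pad4Anchor E₀).X 2) {Z : Scheme.{0}}
    (i : Z ⟶ (pad4Anchor E₀).X.left) : Prop :=
  ∃ c ∈ classesSupportedOn (pad4Anchor E₀).X (Set.range i.base) (2 * 4),
    IsRationalClass c ∧ HasWeilPart ψ₀ c ∧ MixedPartInLine hψ h c

/-- `h_K = symH ψ e a` is rational for rational `a`. -/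
theorem isRationalClass_symH {P : AbelianVariety ℂ} (ψ : P ⟶ P) (e : ProjectiveEmbedding P.X)
    {a : complexBetti (projectiveSpace e.n ℂ) 2} (ha : IsRationalClass a) : IsRationalClass (symH ψ e a) := by
  have h1 : IsRationalClass (complexBetti.map e.ι 2 a) := isRationalClass_complexBetti_map _ ha
  show IsRationalClass (((1 : ℕ) : ℂ) • complexBetti.map e.ι 2 a +
    complexBetti.map ψ.hom.hom.hom 2 (complexBetti.map e.ι 2 a))
  rw [Nat.cast_one, one_smul]
  exact h1.add (isRationalClass_complexBetti_map _ h1)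

/-- **v4's (σ) `ClassCheck K μ i q` implies the frame-free check** for `h = h_K` (given `h_K⁴ ∈ W'₈` — v8
`cupPowTwo_symH_mem_balanced` + `balanced_le_mixedPart`; a hypothesis here because v8 is not importable). -/
theorem ClassCheck.classCheckFree (hψ : ψ₀ ≫ ψ₀ = -(1 • 𝟙 E₀)) {K : AnchorKit E₀ ψ₀} {μ : GaussianInt}
    {Z : Scheme.{0}} {i : Z ⟶ (pad4Anchor E₀).X.left} {q : ℚ} (hc : ClassCheck K μ i q)
    (hh : cupPowTwo (symH (pad4Action E₀ ψ₀) K.pol.e K.pol.a) 4 ∈ mixedPart₈ E₀ ψ₀) :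
    ClassCheckFree hψ (symH (pad4Action E₀ ψ₀) K.pol.e K.pol.a) i := by
  obtain ⟨hμ, hsupp⟩ := hc
  obtain ⟨hl, hπ⟩ := mixedPartInLine_of_eq hψ hh (K.F.wOf_mem μ) rfl
  refine ⟨_, hsupp, ?_, ?_, hl⟩
  · exact (((isRationalClass_symH _ _ K.pol.a_rational).cupPowTwo 4).smul q).add (K.F.wOf_rational μ)
  · rw [hasWeilPart_iff_weilPlaneProj_ne_zero hψ, hπ]
    exact K.F.wOf_ne_zero hμ

/-- **… and CONVERSELY, up to scale: the frame-free check yields v4's (σ) `ClassCheck K μ i q` for the READ-OFF `μ`**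
(`dim E₀ = 1`; the supported class used is `N • c`). So (σ) is a property of the supported rational classes of `Z`
alone; kit, frame and design only NAME `μ`. -/
theorem ClassCheckFree.exists_classCheck (hE : E₀.dim = 1) (hψ : ψ₀ ≫ ψ₀ = -(1 • 𝟙 E₀)) (K : AnchorKit E₀ ψ₀)
    {Z : Scheme.{0}} {i : Z ⟶ (pad4Anchor E₀).X.left}
    (hc : ClassCheckFree hψ (symH (pad4Action E₀ ψ₀) K.pol.e K.pol.a) i) :
    ∃ (μ : GaussianInt) (q : ℚ), ClassCheck K μ i q := by
  obtain ⟨c, hcZ, hcq, hσ, q, hq⟩ := hc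
  obtain ⟨N, μ, hN, hμ⟩ := K.F.exists_nsmul_weilPlaneProj_eq_wOf hE hψ hcq
  refine ⟨μ, (N : ℚ) * q, (K.F.hasWeilPart_iff_of_nsmul_eq hψ hN hμ).mp hσ, ?_⟩
  have e : ((((N : ℚ) * q : ℚ)) : ℂ) • cupPowTwo (symH (pad4Action E₀ ψ₀) K.pol.e K.pol.a) 4 + K.F.wOf μ =
      ((N : ℕ) : ℂ) • c := by
    rw [← hμ, Rat.cast_mul, Rat.cast_natCast, mul_smul, ← hq, ← smul_add, sub_add_cancel]
  rw [e]
  exact Submodule.smul_mem _ _ hcZ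

/-- **(A1@Z)∘ FOR THE SHEAF DOOR, frame-free**, in the degree window `I`: `ch_p(𝓔) ∈ ℚ·hᵖ` (`p ∈ I ∖ {4}`) and
`ch₄(𝓔) ∈ ℚ·h⁴ ⊕ W_K` — v4's `CleanAtSeed C I F h 𝓔 μ` with `wOf μ` replaced by `π_W ch₄(𝓔)`. -/
def CleanAtSeedFree (C : ChernCharacterBetti) (I : Finset ℕ) (hψ : ψ₀ ≫ ψ₀ = -(1 • 𝟙 E₀))
    (h : complexBetti (pad4Anchor E₀).X 2) (𝓔 : (pad4Anchor E₀).X.left.Modules) : Prop :=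
  (∀ p ∈ I, p ≠ 4 → ∃ c : ℚ, C.ch (pad4Anchor E₀).X 𝓔 p = ((c : ℚ) : ℂ) • cupPowTwo h p) ∧
    MixedPartInLine hψ h (C.ch (pad4Anchor E₀).X 𝓔 4)

/-- v4's (A1@Z) implies the frame-free one, with Weil part `wOf μ` (given `h⁴ ∈ W'₈`). -/
theorem CleanAtSeed.cleanAtSeedFree (hψ : ψ₀ ≫ ψ₀ = -(1 • 𝟙 E₀)) {C : ChernCharacterBetti} {I : Finset ℕ}
    {F : WeilFrame E₀ ψ₀} {h : complexBetti (pad4Anchor E₀).X 2} {𝓔 : (pad4Anchor E₀).X.left.Modules}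
    {μ : GaussianInt} (hcl : CleanAtSeed C I F h 𝓔 μ) (hh : cupPowTwo h 4 ∈ mixedPart₈ E₀ ψ₀) :
    CleanAtSeedFree C I hψ h 𝓔 ∧ weilPlaneProj₈ hψ (C.ch (pad4Anchor E₀).X 𝓔 4) = F.wOf μ := by
  obtain ⟨c, q, hc, hq⟩ := hcl
  obtain ⟨hl, hπ⟩ := mixedPartInLine_of_eq hψ hh (F.wOf_mem μ) hq
  exact ⟨⟨fun p hp hp4 => ⟨c p, hc p hp hp4⟩, hl⟩, hπ⟩

/-- conversely, for a VECTOR BUNDLE (rational `ch`, `ChernCharacterBetti.isRationalClass_ch`) the frame-free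
cleanliness gives v4's degree-`8` shape up to the scale `N`, with the READ-OFF `μ`, and (σ)∘ on `ch₄(𝓔)` is `μ ≠ 0`. -/
theorem CleanAtSeedFree.exists_nsmul_eq (hE : E₀.dim = 1) (hψ : ψ₀ ≫ ψ₀ = -(1 • 𝟙 E₀))
    {C : ChernCharacterBetti} {I : Finset ℕ} (F : WeilFrame E₀ ψ₀) {h : complexBetti (pad4Anchor E₀).X 2}
    {𝓔 : (pad4Anchor E₀).X.left.Modules} (h𝓔 : Motives.IsVectorBundle 𝓔) (hcl : CleanAtSeedFree C I hψ h 𝓔) :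
    ∃ (N : ℕ) (μ : GaussianInt) (q : ℚ), 0 < N ∧
      ((N : ℕ) : ℂ) • C.ch (pad4Anchor E₀).X 𝓔 4 = ((q : ℚ) : ℂ) • cupPowTwo h 4 + F.wOf μ ∧
        (HasWeilPart ψ₀ (C.ch (pad4Anchor E₀).X 𝓔 4) ↔ μ ≠ 0) := by
  obtain ⟨-, q, hq⟩ := hcl
  obtain ⟨N, μ, hN, hμ⟩ := F.exists_nsmul_weilPlaneProj_eq_wOf hE hψ (C.isRationalClass_ch _ 𝓔 h𝓔 4)
  refine ⟨N, μ, (N : ℚ) * q, hN, ?_, F.hasWeilPart_iff_of_nsmul_eq hψ hN hμ⟩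
  rw [← hμ, Rat.cast_mul, Rat.cast_natCast, mul_smul, ← hq, ← smul_add, sub_add_cancel]

end AnchorDescent

end Summit.HodgeConjecture.HodgeConjecture.Cruxes.BlochSeedDiscOne.SeedChecker
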